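import Summits.AtomisticToContinuum.HydrodynamicLimit.Theorems.MourreKoopmanChargesStressStrongMixingTorusStressRawEqCov
import Summits.AtomisticToContinuum.HydrodynamicLimit.Theorems.AntiMazurCoboundariesBoltzmannGreenKuboGibbsStatics
import Summits.AtomisticToContinuum.HydrodynamicLimit.Theorems.BoltzmannGreenKubo.Negative.QuadraticStatics
import Literature.MathematicalPhysics.KineticTheory.HardSphereTwoTimePressure
import Literature.MathematicalPhysics.KineticTheory.InfiniteChainCovarianceMixingBox
import HarnessLib

/-!
# `StressStrongMixing` · line `birth`: exact equal-time statics of the torus stress field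
# (`c(0) = θ²` at every `N`) and the uniform two-time bound

Support file for the crux item stmt-AtomisticToContinuum-9584 (`StressStrongMixing`, route
`MourreKoopmanCharges` of `AtomisticToContinuum/HydrodynamicLimit`), line `birth`
(`Cruxes/StressStrongMixing/Lines/birth.lean`).  The crux asks for `c : ℝ → ℝ`, `c(s) → 0`, with
`M_N(s) := (N+1)·E_{G_N}[Π(χ₁)(Φ_{s(N+1)^{-1/3}} z)·Π(χ₂)(z)] → c(s)·∫χ₁χ₂`,
`Π(χ)(z) = (N+1)⁻¹ Σᵢ χ(xᵢ) vᵢ⁰vᵢ¹`, under the canonical Gibbs law at rest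
`G_N = localGibbsLaw σ 1 0 θ N (Φ N)`.  Two finite-`N` facts every line for this crux uses are proved here:

* **exact statics** (`scaled_integral_stressField_mul_stressField`): for `σ ≤ 1/2`, `θ > 0` and EVERY `N`,
  `(N+1)·E_{G_N}[Π(χ₁)·Π(χ₂)] = θ²·∫χ₁χ₂` — under `G_N` the rescaled velocities are i.i.d. standard Gaussians
  independent of the positions and each position is Haar distributed
  (`BoltzmannGreenKuboGibbsStatics.measurePreserving_gibbsParam`, `map_eval_posGibbsMeasure`); the cross terms
  vanish (`w⁰w¹` is centred), the diagonal ones factorise (`E_γ[(w⁰w¹)²] = 1`).  Hence the crux's constant is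
  pinned at time zero: `M_N(0) = θ²·∫χ₁χ₂` for every `N` (`torusStressMoment_zero`, the flow at time `0` being
  the identity `G_N`-a.e.), i.e. `c(0) = θ²` whenever `∫χ₁χ₂ ≠ 0`;
* **uniform bound** (`abs_torusStressMoment_le`): `|M_N(t)| ≤ θ²·(∫χ₁²)^{1/2}·(∫χ₂²)^{1/2}` for every real
  time `t` and every `N` (Cauchy–Schwarz in `L²(G_N)` and invariance of `G_N` under the hard-sphere flow,
  `measurePreserving_flow_localGibbsLaw_const`), so any limit `c(s)·∫χ₁χ₂` obeys the same bound.

References: H. Spohn, *Large Scale Dynamics of Interacting Particles* (1991), Part I §2.3 and §7.1 (7.6)–(7.7).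
-/

noncomputable section

open MeasureTheory ProbabilityTheory Filter Topology
open scoped InnerProductSpace ENNReal

namespace Summit.AtomisticToContinuum.HydrodynamicLimit.Theorems.MourreKoopmanChargesStressStrongMixing

open Literature.MathematicalPhysics.KineticTheory Literature.Analysis.FluidPDE
open BoltzmannGreenKuboOrthMomentum BoltzmannGreenKuboGibbsStatics BoltzmannGreenKuboQuadraticMazur

/-! ### The reduced shear-stress germ `g_θ(w) = (√θ w⁰)(√θ w¹)` under the standard Gaussian -/

/-- The reduced shear-stress germ `g_θ(w) = (√θ w⁰)(√θ w¹)` (so that `g_θ((v - 0)/√θ) = v⁰v¹`). [folklore] -/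
theorem measurable_stressGerm (θ : ℝ) :
    Measurable fun w : V3 => Real.sqrt θ * w 0 * (Real.sqrt θ * w 1) :=
  (measurable_const.mul (measurable_coord 0)).mul (measurable_const.mul (measurable_coord 1))

/-- `g_θ` is centred under `γ` (odd under `w⁰ ↦ -w⁰`; independence of the coordinates). [folklore] -/
theorem integral_stressGerm (θ : ℝ) :
    ∫ w : V3, Real.sqrt θ * w 0 * (Real.sqrt θ * w 1) ∂stdGaussian V3 = 0 := by
  have h := integral_coord_mul_coord_of_ne (k := 0) (l := 1) (by decide)
    (f := fun x => Real.sqrt θ * x) (g := fun x => Real.sqrt θ * x)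
    (measurable_const.mul measurable_id) (measurable_const.mul measurable_id)
  rw [h]
  have h0 : ∫ w : V3, Real.sqrt θ * w 0 ∂stdGaussian V3 = 0 := by
    rw [integral_const_mul, integral_coord_stdGaussian, mul_zero]
  rw [h0, zero_mul]

/-- `E_γ[g_θ²] = θ²` (independence of the coordinates, unit variances). [folklore] -/
theorem integral_stressGerm_sq {θ : ℝ} (hθ : 0 ≤ θ) :
    ∫ w : V3, (Real.sqrt θ * w 0 * (Real.sqrt θ * w 1)) * (Real.sqrt θ * w 0 * (Real.sqrt θ * w 1))
      ∂stdGaussian V3 = θ ^ 2 := by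
  have hsq : Real.sqrt θ * Real.sqrt θ = θ := Real.mul_self_sqrt hθ
  have hrw : ∀ w : V3, (Real.sqrt θ * w 0 * (Real.sqrt θ * w 1)) * (Real.sqrt θ * w 0 * (Real.sqrt θ * w 1)) =
      ((Real.sqrt θ * Real.sqrt θ) * (w 0 * w 0)) * ((Real.sqrt θ * Real.sqrt θ) * (w 1 * w 1)) := by
    intro w
    ring
  simp_rw [hrw, hsq]
  have hm : Measurable fun x : ℝ => θ * (x * x) := measurable_const.mul (measurable_id.mul measurable_id)
  rw [integral_coord_mul_coord_of_ne (k := 0) (l := 1) (by decide) (f := fun x => θ * (x * x))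
    (g := fun x => θ * (x * x)) hm hm]
  have h2 : ∀ k : Fin 3, ∫ w : V3, θ * (w k * w k) ∂stdGaussian V3 = θ := by
    intro k
    rw [integral_const_mul]
    simp_rw [← sq]
    rw [integral_coord_sq_stdGaussian, mul_one]
  rw [h2 0, h2 1, sq]

/-- `g_θ ∈ L²(γ)` (`g_θ² ≤ θ²(w⁰⁴ + w¹⁴)/2`, fourth Gaussian moments). [folklore] -/
theorem memLp_stressGerm (θ : ℝ) :
    MemLp (fun w : V3 => Real.sqrt θ * w 0 * (Real.sqrt θ * w 1)) 2 (stdGaussian V3) := by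
  refine (memLp_two_iff_integrable_sq (measurable_stressGerm θ).aestronglyMeasurable).2 ?_
  have hb : Integrable (fun w : V3 => (Real.sqrt θ) ^ 4 * ((w 0) ^ 4 + (w 1) ^ 4)) (stdGaussian V3) :=
    ((integrable_coord_pow_four' 0).add (integrable_coord_pow_four' 1)).const_mul _
  refine hb.mono' ((measurable_stressGerm θ).pow_const 2).aestronglyMeasurable
    (Eventually.of_forall fun w => ?_)
  rw [Real.norm_eq_abs, abs_of_nonneg (sq_nonneg _)]
  have h4 : 0 ≤ (Real.sqrt θ) ^ 4 := by positivity
  have key : (Real.sqrt θ * w 0 * (Real.sqrt θ * w 1)) ^ 2 = (Real.sqrt θ) ^ 4 * ((w 0) ^ 2 * (w 1) ^ 2) := by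
    ring
  rw [key]
  refine mul_le_mul_of_nonneg_left ?_ h4
  nlinarith [sq_nonneg ((w 0) ^ 2 - (w 1) ^ 2), sq_nonneg (w 0), sq_nonneg (w 1)]

/-! ### Two-test-function statics on the product space `μ ⊗ γ^{⊗n}` -/

section Statics

variable {n : ℕ} (μ : Measure (Fin n → T3)) [IsProbabilityMeasure μ]

/-- A bounded position factor times an `L²(γ)` velocity factor is in `L²(μ ⊗ γ^{⊗n})` (bound `C`). [folklore] -/
theorem memLp_term' {φ : T3 → ℝ} (hφm : Measurable φ) {C : ℝ} (hφb : ∀ x, |φ x| ≤ C) {f : V3 → ℝ}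
    (hf : MemLp f 2 (stdGaussian V3)) (i j : Fin n) :
    MemLp (fun p : (Fin n → T3) × (Fin n → V3) => φ (p.1 i) * f (p.2 j)) 2
      (μ.prod (Measure.pi fun _ : Fin n => stdGaussian V3)) := by
  -- adapted from `BoltzmannGreenKuboGibbsStatics.memLp_term` (bound `1` there)
  have h1 : MemLp (fun p : (Fin n → T3) × (Fin n → V3) => φ (p.1 i)) ∞
      (μ.prod (Measure.pi fun _ : Fin n => stdGaussian V3)) :=
    memLp_top_of_bound (hφm.comp ((measurable_pi_apply i).comp measurable_fst)).aestronglyMeasurable C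
      (Eventually.of_forall fun p => by rw [Real.norm_eq_abs]; exact hφb _)
  have h2 : MemLp (fun p : (Fin n → T3) × (Fin n → V3) => f (p.2 j)) 2
      (μ.prod (Measure.pi fun _ : Fin n => stdGaussian V3)) :=
    hf.comp_measurePreserving (measurePreserving_vel μ j)
  exact h2.mul' h1

omit [IsProbabilityMeasure μ] in
/-- **Factorised two-point function of one term, two test functions**:
`∫ φ₁(xᵢ)f₁(wᵢ) · φ₂(xⱼ)f₂(wⱼ) d(μ ⊗ γ^⊗) = (∫ φ₁(xᵢ)φ₂(xⱼ) dμ)(∫ f₁(wᵢ)f₂(wⱼ) dγ^⊗)`. [folklore] -/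
theorem integral_term_mul_term₂ [SFinite μ] (φ₁ φ₂ : T3 → ℝ) (f₁ f₂ : V3 → ℝ) (i j : Fin n) :
    ∫ p, φ₁ (p.1 i) * f₁ (p.2 i) * (φ₂ (p.1 j) * f₂ (p.2 j))
        ∂(μ.prod (Measure.pi fun _ : Fin n => stdGaussian V3)) =
      (∫ x, φ₁ (x i) * φ₂ (x j) ∂μ) *
        ∫ w, f₁ (w i) * f₂ (w j) ∂(Measure.pi fun _ : Fin n => stdGaussian V3) := by
  rw [← integral_prod_mul (μ := μ) (ν := Measure.pi fun _ : Fin n => stdGaussian V3)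
    (fun x : Fin n → T3 => φ₁ (x i) * φ₂ (x j)) (fun w : Fin n → V3 => f₁ (w i) * f₂ (w j))]
  refine integral_congr_ae (Eventually.of_forall fun p => ?_)
  simp only
  ring

/-- **Exact statics on the product space, two test functions**: if every one-particle marginal of `μ`
is Haar, `φ₁, φ₂` are bounded measurable and `f₁, f₂ ∈ L²(γ)` with `f₁` centred, then
`∫ (Σᵢ φ₁(xᵢ)f₁(wᵢ))(Σⱼ φ₂(xⱼ)f₂(wⱼ)) d(μ ⊗ γ^{⊗n}) = n (∫ φ₁φ₂) ∫ f₁f₂ dγ`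
(cross terms vanish by independence of distinct particles, diagonal terms factorise). [folklore] -/
theorem integral_field_mul_field₂ (hμ : ∀ i : Fin n, μ.map (fun x => x i) = volume) {φ₁ φ₂ : T3 → ℝ}
    (hφ₁m : Measurable φ₁) (hφ₂m : Measurable φ₂) {C₁ C₂ : ℝ} (hφ₁b : ∀ x, |φ₁ x| ≤ C₁)
    (hφ₂b : ∀ x, |φ₂ x| ≤ C₂) {f₁ f₂ : V3 → ℝ} (hf₁m : Measurable f₁) (hf₂m : Measurable f₂)
    (hf₁ : MemLp f₁ 2 (stdGaussian V3)) (hf₂ : MemLp f₂ 2 (stdGaussian V3))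
    (hc₁ : ∫ v, f₁ v ∂(stdGaussian V3) = 0) :
    ∫ p, (∑ i, φ₁ (p.1 i) * f₁ (p.2 i)) * (∑ i, φ₂ (p.1 i) * f₂ (p.2 i))
        ∂(μ.prod (Measure.pi fun _ : Fin n => stdGaussian V3)) =
      n * (∫ x, φ₁ x * φ₂ x) * ∫ v, f₁ v * f₂ v ∂(stdGaussian V3) := by
  -- adapted from `BoltzmannGreenKuboGibbsStatics.integral_field_mul_field` (one test function there)
  have hint : ∀ i j, Integrable (fun p : (Fin n → T3) × (Fin n → V3) =>
      φ₁ (p.1 i) * f₁ (p.2 i) * (φ₂ (p.1 j) * f₂ (p.2 j)))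
      (μ.prod (Measure.pi fun _ : Fin n => stdGaussian V3)) :=
    fun i j => (memLp_term' μ hφ₁m hφ₁b hf₁ i i).integrable_mul (memLp_term' μ hφ₂m hφ₂b hf₂ j j)
  simp_rw [Finset.sum_mul_sum]
  rw [integral_finsetSum _ fun i _ => integrable_finsetSum _ fun j _ => hint i j]
  have hdiag : ∀ i, ∫ p, φ₁ (p.1 i) * f₁ (p.2 i) * (φ₂ (p.1 i) * f₂ (p.2 i))
      ∂(μ.prod (Measure.pi fun _ : Fin n => stdGaussian V3)) =
      (∫ x, φ₁ x * φ₂ x) * ∫ v, f₁ v * f₂ v ∂(stdGaussian V3) := by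
    intro i
    rw [integral_term_mul_term₂, integral_diag (stdGaussian V3) (fun w => f₁ w * f₂ w) (hf₁m.mul hf₂m) i]
    congr 1
    rw [← hμ i, integral_map (measurable_pi_apply i).aemeasurable (hφ₁m.mul hφ₂m).aestronglyMeasurable]
  have hoff : ∀ i j, i ≠ j → ∫ p, φ₁ (p.1 i) * f₁ (p.2 i) * (φ₂ (p.1 j) * f₂ (p.2 j))
      ∂(μ.prod (Measure.pi fun _ : Fin n => stdGaussian V3)) = 0 := by
    intro i j hij
    rw [integral_term_mul_term₂, BoltzmannGreenKuboGibbsStatics.integral_pi_mul_of_ne hij hf₁m hf₂m, hc₁,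
      zero_mul, mul_zero]
  have hi : ∀ i, ∫ p, ∑ j, φ₁ (p.1 i) * f₁ (p.2 i) * (φ₂ (p.1 j) * f₂ (p.2 j))
      ∂(μ.prod (Measure.pi fun _ : Fin n => stdGaussian V3)) =
      (∫ x, φ₁ x * φ₂ x) * ∫ v, f₁ v * f₂ v ∂(stdGaussian V3) := by
    intro i
    rw [integral_finsetSum _ fun j _ => hint i j,
      Finset.sum_eq_single i (fun j _ hji => hoff i j (Ne.symm hji))
        (fun h => (h (Finset.mem_univ i)).elim), hdiag]
  simp only [hi, Finset.sum_const, Finset.card_univ, Fintype.card_fin, nsmul_eq_mul]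
  ring

end Statics

/-! ### Exact equal-time statics of the stress field under the canonical Gibbs law -/

/-- **The one-body stress sums are in `L²(G_N)` and their equal-time second moment is exact**: under the
canonical Gibbs law at rest `G_N = localGibbsLaw σ 1 0 θ N Φ` (`σ ≤ 1/2`, `θ > 0`), for continuous `χ₁, χ₂`,
`Σᵢ χ(xᵢ) vᵢ⁰vᵢ¹ ∈ L²(G_N)` and `∫ (Σᵢ χ₁(xᵢ)vᵢ⁰vᵢ¹)(Σⱼ χ₂(xⱼ)vⱼ⁰vⱼ¹) dG_N = (N+1)·θ²·∫χ₁χ₂`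
(transport to `posGibbsMeasure ⊗ γ^{⊗(N+1)}` by `measurePreserving_gibbsParam`, Haar marginals
`map_eval_posGibbsMeasure`, `integral_field_mul_field₂` with the germ `g_θ`). [folklore] -/
theorem memLp_and_integral_stressSum_mul_stressSum {σ θ : ℝ} (hσ : σ ≤ 1 / 2) (hθ : 0 < θ) (N : ℕ)
    (Φ : HardSphereFlow (Torus.geometry (Fin 3)) (hsDiameter σ N) (N + 1)) {χ₁ χ₂ : T3 → ℝ}
    (hχ₁ : Continuous χ₁) (hχ₂ : Continuous χ₂) :
    MemLp (fun z : Config (N + 1) (Fin 3) T3 => ∑ i, χ₁ (z i).1 * ((z i).2 0 * (z i).2 1)) 2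
        (localGibbsLaw σ (fun _ => 1) (fun _ => 0) (fun _ => θ) N Φ) ∧
      ∫ z, (∑ i, χ₁ (z i).1 * ((z i).2 0 * (z i).2 1)) * (∑ i, χ₂ (z i).1 * ((z i).2 0 * (z i).2 1))
          ∂(localGibbsLaw σ (fun _ => 1) (fun _ => 0) (fun _ => θ) N Φ) =
        ((N : ℝ) + 1) * θ ^ 2 * ∫ x, χ₁ x * χ₂ x := by
  haveI := isProbabilityMeasure_posGibbsMeasure (a₀ := fun _ => (1 : ℝ)) continuous_const
    (fun _ => one_pos) hσ N
  have hZ := measurePreserving_gibbsParam hσ one_pos hθ (0 : V3) N Φ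
  have hHaar : ∀ i : Fin (N + 1),
      (posGibbsMeasure (fun _ => (1 : ℝ)) (hsDiameter σ N) (N + 1)).map (fun x => x i) = volume :=
    fun i => map_eval_posGibbsMeasure hσ one_pos N i
  obtain ⟨C₁, -, hC₁⟩ := exists_forall_abs_le_of_continuous hχ₁
  obtain ⟨C₂, -, hC₂⟩ := exists_forall_abs_le_of_continuous hχ₂
  -- the stress sums pulled back to the product space are one-body fields with the germ `g_θ`
  have hcomp : ∀ χ : T3 → ℝ,
      ((fun z : Config (N + 1) (Fin 3) T3 => ∑ i, χ (z i).1 * ((z i).2 0 * (z i).2 1)) ∘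
        fun p : (Fin (N + 1) → T3) × (Fin (N + 1) → V3) =>
          zipConfig (p.1, fun i => (0 : V3) + Real.sqrt θ • p.2 i)) =
      fun p => ∑ i, χ (p.1 i) * (Real.sqrt θ * p.2 i 0 * (Real.sqrt θ * p.2 i 1)) := by
    intro χ
    funext p
    simp only [Function.comp_apply, zipConfig_apply, zero_add, PiLp.smul_apply, smul_eq_mul]
  have hmeasS : ∀ {χ : T3 → ℝ}, Continuous χ →
      Measurable fun z : Config (N + 1) (Fin 3) T3 => ∑ i, χ (z i).1 * ((z i).2 0 * (z i).2 1) := by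
    intro χ hχ
    have hF : Continuous fun y : T3 × V3 => χ y.1 * (y.2 0 * y.2 1) := by fun_prop
    exact Finset.measurable_sum _ fun i _ => hF.measurable.comp (measurable_pi_apply i)
  have hmem : ∀ {χ : T3 → ℝ} (hχ : Continuous χ) {C : ℝ} (_hC : ∀ x, |χ x| ≤ C),
      MemLp (fun z : Config (N + 1) (Fin 3) T3 => ∑ i, χ (z i).1 * ((z i).2 0 * (z i).2 1)) 2
        (localGibbsLaw σ (fun _ => 1) (fun _ => 0) (fun _ => θ) N Φ) := by
    intro χ hχ C hC
    rw [← hZ.map_eq]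
    refine (memLp_map_measure_iff (hmeasS hχ).aestronglyMeasurable hZ.measurable.aemeasurable).2 ?_
    rw [hcomp χ]
    exact memLp_finsetSum _ fun i _ => memLp_term' _ hχ.measurable hC (memLp_stressGerm θ) i i
  refine ⟨hmem hχ₁ hC₁, ?_⟩
  rw [← hZ.map_eq]
  have hFm : AEStronglyMeasurable (fun z : Config (N + 1) (Fin 3) T3 =>
      (∑ i, χ₁ (z i).1 * ((z i).2 0 * (z i).2 1)) * (∑ i, χ₂ (z i).1 * ((z i).2 0 * (z i).2 1)))
      (Measure.map (fun p : (Fin (N + 1) → T3) × (Fin (N + 1) → V3) =>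
          zipConfig (p.1, fun i => (0 : V3) + Real.sqrt θ • p.2 i))
        ((posGibbsMeasure (fun _ => (1 : ℝ)) (hsDiameter σ N) (N + 1)).prod
          (Measure.pi fun _ : Fin (N + 1) => stdGaussian V3))) :=
    ((hmeasS hχ₁).mul (hmeasS hχ₂)).aestronglyMeasurable
  rw [integral_map hZ.measurable.aemeasurable hFm]
  have hprod : (fun p : (Fin (N + 1) → T3) × (Fin (N + 1) → V3) =>
      (∑ i, χ₁ ((zipConfig (p.1, fun i => (0 : V3) + Real.sqrt θ • p.2 i)) i).1 *
          (((zipConfig (p.1, fun i => (0 : V3) + Real.sqrt θ • p.2 i)) i).2 0 *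
            ((zipConfig (p.1, fun i => (0 : V3) + Real.sqrt θ • p.2 i)) i).2 1)) *
        (∑ i, χ₂ ((zipConfig (p.1, fun i => (0 : V3) + Real.sqrt θ • p.2 i)) i).1 *
          (((zipConfig (p.1, fun i => (0 : V3) + Real.sqrt θ • p.2 i)) i).2 0 *
            ((zipConfig (p.1, fun i => (0 : V3) + Real.sqrt θ • p.2 i)) i).2 1))) =
      fun p => (∑ i, χ₁ (p.1 i) * (Real.sqrt θ * p.2 i 0 * (Real.sqrt θ * p.2 i 1))) *
        (∑ i, χ₂ (p.1 i) * (Real.sqrt θ * p.2 i 0 * (Real.sqrt θ * p.2 i 1))) := by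
    funext p
    simp only [zipConfig_apply, zero_add, PiLp.smul_apply, smul_eq_mul]
  rw [hprod, integral_field_mul_field₂ _ hHaar hχ₁.measurable hχ₂.measurable hC₁ hC₂
    (measurable_stressGerm θ) (measurable_stressGerm θ) (memLp_stressGerm θ) (memLp_stressGerm θ)
    (integral_stressGerm θ), integral_stressGerm_sq hθ.le]
  push_cast
  ring

/-- **Exact equal-time statics of the empirical stress fields** (`c(0) = θ²` at every `N`): for `σ ≤ 1/2`,
`θ > 0`, every flow, continuous `χ₁, χ₂` and every `N`,
`(N+1) · E_{G_N}[Π(χ₁)(z) · Π(χ₂)(z)] = θ² · ∫χ₁χ₂`, `Π(χ)(z) = ∫ χ(y.1)(y.2 0 · y.2 1) d(empiricalMeasure z)`.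
[folklore] -/
theorem scaled_integral_stressField_mul_stressField {σ θ : ℝ} (hσ : σ ≤ 1 / 2) (hθ : 0 < θ) (N : ℕ)
    (Φ : HardSphereFlow (Torus.geometry (Fin 3)) (hsDiameter σ N) (N + 1)) {χ₁ χ₂ : T3 → ℝ}
    (hχ₁ : Continuous χ₁) (hχ₂ : Continuous χ₂) :
    ((N : ℝ) + 1) * ∫ z, (∫ y, χ₁ y.1 * (y.2 0 * y.2 1) ∂(empiricalMeasure z)) *
        (∫ y, χ₂ y.1 * (y.2 0 * y.2 1) ∂(empiricalMeasure z))
        ∂(localGibbsLaw σ (fun _ => 1) (fun _ => 0) (fun _ => θ) N Φ) =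
      θ ^ 2 * ∫ x, χ₁ x * χ₂ x := by
  have hN : ((N : ℝ) + 1) ≠ 0 := by positivity
  have hrw : ∀ z : Config (N + 1) (Fin 3) T3,
      (∫ y, χ₁ y.1 * (y.2 0 * y.2 1) ∂(empiricalMeasure z)) * (∫ y, χ₂ y.1 * (y.2 0 * y.2 1) ∂(empiricalMeasure z)) =
        (((N : ℝ) + 1)⁻¹ * ((N : ℝ) + 1)⁻¹) *
          ((∑ i, χ₁ (z i).1 * ((z i).2 0 * (z i).2 1)) * (∑ i, χ₂ (z i).1 * ((z i).2 0 * (z i).2 1))) := by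
    intro z
    rw [stressField_eq_sum χ₁ z, stressField_eq_sum χ₂ z]
    push_cast
    ring
  simp_rw [hrw]
  rw [integral_const_mul, (memLp_and_integral_stressSum_mul_stressSum hσ hθ N Φ hχ₁ hχ₂).2]
  field_simp

/-- **The crux's moment at time zero is `θ²·∫χ₁χ₂` for every `N`** (`M_N(0) = θ²∫χ₁χ₂`, so `c(0) = θ²`):
the time-`0` map of a hard-sphere flow is the identity on its good set, which carries `G_N`
(`ae_mem_good_localGibbsLaw`), and the equal-time statics is `scaled_integral_stressField_mul_stressField`.
[folklore] -/
theorem torusStressMoment_zero :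
    ∀ σ : ℝ, σ ≤ 1 / 2 → ∀ θ : ℝ, 0 < θ →
      ∀ Φ : (N : ℕ) → HardSphereFlow (Torus.geometry (Fin 3)) (hsDiameter σ N) (N + 1),
      ∀ χ₁ χ₂ : T3 → ℝ, Continuous χ₁ → Continuous χ₂ → ∀ N : ℕ,
        ((N : ℝ) + 1) * ∫ z, (∫ y, χ₁ y.1 * (y.2 0 * y.2 1)
            ∂(empiricalMeasure ((Φ N).flow (0 * ((N : ℝ) + 1) ^ (-(1 / 3 : ℝ))) z))) *
          (∫ y, χ₂ y.1 * (y.2 0 * y.2 1) ∂(empiricalMeasure z))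
          ∂(localGibbsLaw σ (fun _ => 1) (fun _ => 0) (fun _ => θ) N (Φ N)) =
        θ ^ 2 * ∫ x, χ₁ x * χ₂ x := by
  intro σ hσ θ hθ Φ χ₁ χ₂ hχ₁ hχ₂ N
  rw [zero_mul, ← scaled_integral_stressField_mul_stressField hσ hθ N (Φ N) hχ₁ hχ₂]
  congr 1
  refine integral_congr_ae ?_
  filter_upwards [ae_mem_good_localGibbsLaw σ (fun _ => 1) (fun _ => 0) (fun _ => θ) N (Φ N)] with z hz
  rw [(Φ N).flow_zero z hz]

/-! ### The uniform two-time bound -/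

/-- `c · (√p · √q) = √(c p) · √(c q)` for `c ≥ 0`. [folklore] -/
theorem mul_sqrt_mul_sqrt {c : ℝ} (hc : 0 ≤ c) (p q : ℝ) :
    c * (Real.sqrt p * Real.sqrt q) = Real.sqrt (c * p) * Real.sqrt (c * q) := by
  rw [Real.sqrt_mul hc, Real.sqrt_mul hc]
  have hs := Real.mul_self_sqrt hc
  linear_combination (-(Real.sqrt p * Real.sqrt q)) * hs

/-- **Uniform bound on the crux's two-time moment**: for `σ ≤ 1/2`, `θ > 0`, every flow, continuous `χ₁, χ₂`,
every real time `t` and every `N`,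
`|(N+1) · E_{G_N}[Π(χ₁)(Φ_t z) · Π(χ₂)(z)]| ≤ θ² · (∫χ₁²)^{1/2} · (∫χ₂²)^{1/2}`
(Cauchy–Schwarz in `L²(G_N)`; the time-shifted factor has the norm of the unshifted one by invariance of
`G_N` under the flow; the norms are given by the exact statics). [folklore] -/
theorem abs_torusStressMoment_le :
    ∀ σ : ℝ, σ ≤ 1 / 2 → ∀ θ : ℝ, 0 < θ →
      ∀ Φ : (N : ℕ) → HardSphereFlow (Torus.geometry (Fin 3)) (hsDiameter σ N) (N + 1),
      ∀ χ₁ χ₂ : T3 → ℝ, Continuous χ₁ → Continuous χ₂ → ∀ (t : ℝ) (N : ℕ),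
        |((N : ℝ) + 1) * ∫ z, (∫ y, χ₁ y.1 * (y.2 0 * y.2 1) ∂(empiricalMeasure ((Φ N).flow t z))) *
            (∫ y, χ₂ y.1 * (y.2 0 * y.2 1) ∂(empiricalMeasure z))
            ∂(localGibbsLaw σ (fun _ => 1) (fun _ => 0) (fun _ => θ) N (Φ N))| ≤
          θ ^ 2 * Real.sqrt (∫ x, χ₁ x ^ 2) * Real.sqrt (∫ x, χ₂ x ^ 2) := by
  intro σ hσ θ hθ Φf χ₁ χ₂ hχ₁ hχ₂ t N
  set Φ := Φf N with hΦ
  set G := localGibbsLaw σ (fun _ => 1) (fun _ => 0) (fun _ => θ) N Φ with hG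
  have hN0 : 0 < ((N : ℝ) + 1) := by positivity
  have hT := measurePreserving_flow_localGibbsLaw_const σ 1 θ 0 N Φ t
  -- the two stress fields `X = Π(χ₁)`, `Y = Π(χ₂)` are in `L²(G_N)`
  have hfield : ∀ {χ : T3 → ℝ}, Continuous χ →
      MemLp (fun z : Config (N + 1) (Fin 3) T3 => ∫ y, χ y.1 * (y.2 0 * y.2 1) ∂(empiricalMeasure z)) 2 G := by
    intro χ hχ
    have h := ((memLp_and_integral_stressSum_mul_stressSum hσ hθ N Φ hχ hχ).1).const_mul
      (((N + 1 : ℕ) : ℝ))⁻¹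
    refine h.congr_norm (measurable_stressField hχ).aestronglyMeasurable (Eventually.of_forall fun z => ?_)
    rw [stressField_eq_sum χ z]
  have hX := hfield hχ₁
  have hY := hfield hχ₂
  have hXt : MemLp (fun z : Config (N + 1) (Fin 3) T3 =>
      ∫ y, χ₁ y.1 * (y.2 0 * y.2 1) ∂(empiricalMeasure (Φ.flow t z))) 2 G :=
    hX.comp_measurePreserving hT
  -- second moments: `(N+1) ∫ X² = θ² ∫ χ₁²`, and the same for the time-shifted factor and for `Y`
  have hsqX : ((N : ℝ) + 1) * ∫ z, (∫ y, χ₁ y.1 * (y.2 0 * y.2 1) ∂(empiricalMeasure z)) ^ 2 ∂G =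
      θ ^ 2 * ∫ x, χ₁ x ^ 2 := by
    have h := scaled_integral_stressField_mul_stressField hσ hθ N Φ hχ₁ hχ₁
    simp only [← pow_two] at h
    exact h
  have hsqXt : ((N : ℝ) + 1) *
      ∫ z, (∫ y, χ₁ y.1 * (y.2 0 * y.2 1) ∂(empiricalMeasure (Φ.flow t z))) ^ 2 ∂G =
      θ ^ 2 * ∫ x, χ₁ x ^ 2 := by
    rw [← hsqX]
    congr 1
    exact integral_comp_flow_localGibbsLaw_const σ 1 θ 0 N Φ t
      (((measurable_stressField hχ₁).pow_const 2).aestronglyMeasurable)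
  have hsqY : ((N : ℝ) + 1) * ∫ z, (∫ y, χ₂ y.1 * (y.2 0 * y.2 1) ∂(empiricalMeasure z)) ^ 2 ∂G =
      θ ^ 2 * ∫ x, χ₂ x ^ 2 := by
    have h := scaled_integral_stressField_mul_stressField hσ hθ N Φ hχ₂ hχ₂
    simp only [← pow_two] at h
    exact h
  -- Cauchy–Schwarz
  have hCS := Literature.MathematicalPhysics.KineticTheory.HeatConduction.abs_integral_mul_le_sqrt_integral_sq_mul hXt hY
  rw [abs_mul, abs_of_pos hN0]
  have h1 : 0 ≤ ∫ z, (∫ y, χ₁ y.1 * (y.2 0 * y.2 1) ∂(empiricalMeasure (Φ.flow t z))) ^ 2 ∂G :=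
    integral_nonneg fun _ => sq_nonneg _
  have h2 : 0 ≤ ∫ z, (∫ y, χ₂ y.1 * (y.2 0 * y.2 1) ∂(empiricalMeasure z)) ^ 2 ∂G :=
    integral_nonneg fun _ => sq_nonneg _
  have hθ2 : 0 ≤ θ ^ 2 := sq_nonneg θ
  calc ((N : ℝ) + 1) * |∫ z, (∫ y, χ₁ y.1 * (y.2 0 * y.2 1) ∂(empiricalMeasure (Φ.flow t z))) *
          (∫ y, χ₂ y.1 * (y.2 0 * y.2 1) ∂(empiricalMeasure z)) ∂G|
      ≤ ((N : ℝ) + 1) * (Real.sqrt (∫ z, (∫ y, χ₁ y.1 * (y.2 0 * y.2 1) ∂(empiricalMeasure (Φ.flow t z))) ^ 2 ∂G) *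
          Real.sqrt (∫ z, (∫ y, χ₂ y.1 * (y.2 0 * y.2 1) ∂(empiricalMeasure z)) ^ 2 ∂G)) :=
        mul_le_mul_of_nonneg_left hCS hN0.le
    _ = Real.sqrt (((N : ℝ) + 1) * ∫ z, (∫ y, χ₁ y.1 * (y.2 0 * y.2 1) ∂(empiricalMeasure (Φ.flow t z))) ^ 2 ∂G) *
          Real.sqrt (((N : ℝ) + 1) * ∫ z, (∫ y, χ₂ y.1 * (y.2 0 * y.2 1) ∂(empiricalMeasure z)) ^ 2 ∂G) := by
        exact mul_sqrt_mul_sqrt hN0.le _ _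
    _ = θ ^ 2 * Real.sqrt (∫ x, χ₁ x ^ 2) * Real.sqrt (∫ x, χ₂ x ^ 2) := by
        rw [hsqXt, hsqY, Real.sqrt_mul hθ2, Real.sqrt_mul hθ2, Real.sqrt_sq hθ.le]
        ring

end Summit.AtomisticToContinuum.HydrodynamicLimit.Theorems.MourreKoopmanChargesStressStrongMixing

end
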